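import Literature.NumberTheory.EllipticCurves.BurungaleSkinner2023.X011TwistsCertificateProofs
import Literature.NumberTheory.EllipticCurves.BurungaleSkinner2023.QuadraticCharDiscrProofs
import Literature.NumberTheory.EllipticCurves.LocalTorsionMultiplicativeProofs
import Literature.NumberTheory.EllipticCurves.SzpiroLocalDataProofs
import Literature.NumberTheory.DiophantineGeometry.LocalReductionIsIntegralAtProofs
import HarnessLib

/-!
# Burungale–Skinner 2023 at `p = 3` for the conductor-`14` curve `14A1`: the hypotheses of
# Theorems 2.9 / 3.2 / 3.5 (and of Thm. 2.8 for `ψ = ψ_{ℚ(√−43)}`) KERNEL-CHECKED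

A. Burungale, C. Skinner, Proc. AMS Ser. B 10 (2023), Example (E1) (p. 22): "Consider the curve
14.a3 … This curve has a rational `3`-torsion point and satisfies the hypotheses of Theorem 2.8. In
this case `ϕ = 1`, `S = {7}`, `N = {2}`, and `A = ∅`." The theorems apply verbatim to every curve
with the typed hypotheses; we certify them for Cremona's `14A1 = [1,0,1,4,−6]` (same isogeny class
`14a`, `E(ℚ)_{tors} = ℤ/6`, rational `3`-torsion point `T = (2,2)`), taking `ℓ₀ = 2`
(`r₂ = 1`, tree `numPrimesAbove_three_two`; `2 ≡ −1 (mod 3)` so the additive proviso is void):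

* `M14a1`, `c14a1 = M14a1 ⊗ ℚ`; `Δ = −21952 = −2⁶·7³`, `c₄ = −215` (coprime: semistable);
  `isElliptic_c14a1`, `isGloballyMinimal_c14a1` (Silverman VII.1 Rem. 1.1), **`conductorNorm_c14a1 :
  N = 14`** (semistable integer model: `f_p = 1` iff `p ∣ Δ`, Silverman ATAEC IV.10.2 — generic
  lemmas `conductorNorm_baseChange_int_of_isCoprime` etc. of §0, the Literature twins of the
  `Rank1Residual/X5` toolkit), multiplicative at `2` and `7`, NON-split at `2` (node-tangent quadratic
  `X² + X + 1` irreducible over `𝔽₂`), SPLIT at `7` (`2X² + 2X − 5 = 2(X − 4)(X − 2)` over `𝔽₇`),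
  good at every other prime;
* the `3`-torsion point `T₃ = (2,2)` (`T₃ + T₃ = −T₃`), its image `T̄₃ ∈ E[3]` of order `3`, fixed
  by `Γ_ℚ`; the line `Φ = ⟨T̄₃⟩` (`line_c14a1`: `3` elements, trivial action, `ϕ = 1`);
* **Thm. 2.9 / 3.2 / 3.5 for `14A1`, modulo the named facts**: `posProportion_twists_c14a1`,
  `infinitelyMany_twists_c14a1` (a positive proportion of — hence infinitely many — discriminants
  `d` of imaginary quadratic fields with `rank E^{(d)}(ℚ) = ord_{s=1} L(E^{(d)}, s) = 1`, `λ = 1`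
  and NON-DEGENERATE `3`-adic height on every minimal model of `E^{(d)}`),
  `infinitelyMany_twists_c14a1_pPartBSD` (Thm. 3.2: `3`-part of BSD in rank one),
  `infinitelyMany_evenTwists_c14a1_pPartBSD_rankZero` (Thm. 3.5);
* **Thm. 2.8 for `14A1`, `ℓ₀ = 2`, `ψ = ψ_{ℚ(√−43)}`** (`2, 3, 7` inert in `ℚ(√−43)`, `h = 1`):
  `thm28Hypotheses_c14a1_of_discr_eq_neg_fortyThree`, `twistConclusion_c14a1_neg_fortyThree`
  (the `−43` twist of `14A1`: rank `= ord L = 1`, `Reg₃ ≠ 0`, modulo Thm. 2.8 by name). In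
  particular the typed hypothesis bundle `Thm28Hypotheses` is INHABITED (non-vacuity of the typing).

No new facts (definitions with bodies + theorems).

References: [BurungaleSkinner2023] Example (E1) (p. 22), Thms. 2.8, 2.9 (pp. 20–21), 3.2, 3.5;
[CremonaAlgorithms1997] Table 1, `N = 14`; [SilvermanAEC2009] VII.1 Rem. 1.1, VII.5 Prop. 5.1;
[Silverman1994] IV.10.2; [Marcus2018] Ch. 3 Thm. 25.
-/

noncomputable section

open scoped Classical

open NumberField IsDedekindDomain IsDedekindDomain.HeightOneSpectrum WeierstrassCurve Polynomial
  Literature.NumberTheory.EllipticCurves Literature.NumberTheory.EllipticCurves.Rank1Residual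
  Literature.NumberTheory.QuadraticFields.Quadratic

namespace Literature.NumberTheory.EllipticCurves.BurungaleSkinner2023

/-! ### §0 Semistable integer models: reduction types and conductor (generic) -/

section IntModel

variable (W₀ : WeierstrassCurve ℤ)

/-- If `p_v ∣ Δ(W₀)` and `Δ(W₀)`, `c₄(W₀)` are coprime, then `c₄` is a `v`-unit and `v(Δ) < 1`, so
`W₀ ⊗ ℚ` has multiplicative reduction at `v`. [cite: SilvermanAEC2009, VII.5 Prop. 5.1(b)] -/
theorem hasMultiplicativeReductionAt_baseChange_int_of_isCoprime [(W₀.baseChange ℚ).IsElliptic]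
    (hcop : IsCoprime W₀.Δ W₀.c₄) {v : HeightOneSpectrum ℤ}
    (hv : (Rat.HeightOneSpectrum.natGenerator v : ℤ) ∣ W₀.Δ) :
    (W₀.baseChange ℚ).HasMultiplicativeReductionAt v := by
  refine hasMultiplicativeReductionAt_of_valuation_c₄_eq_one (isIntegralAt_baseChange v W₀) ?_ ?_
  · rw [baseChange_int_c₄, Rat.valuation_intCast_eq_one_iff]
    intro hc
    have hp : (Rat.HeightOneSpectrum.natGenerator v).Prime := Rat.HeightOneSpectrum.prime_natGenerator v
    have h1 : (Rat.HeightOneSpectrum.natGenerator v : ℤ) ∣ 1 := by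
      obtain ⟨a, b, hab⟩ := hcop
      rw [← hab]
      exact dvd_add (dvd_mul_of_dvd_right hv a) (dvd_mul_of_dvd_right hc b)
    have := Int.eq_one_of_dvd_one (by positivity) h1
    exact hp.one_lt.ne' (by exact_mod_cast this)
  · rw [baseChange_int_Δ, Rat.valuation_intCast_lt_one_iff]
    exact hv

/-- If `p_v ∤ Δ(W₀)` then `W₀ ⊗ ℚ` has good reduction at `v`. [cite: SilvermanAEC2009, VII.5 Prop. 5.1(a)] -/
theorem hasGoodReductionAt_baseChange_int_of_not_dvd {v : HeightOneSpectrum ℤ}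
    (hv : ¬ (Rat.HeightOneSpectrum.natGenerator v : ℤ) ∣ W₀.Δ) :
    (W₀.baseChange ℚ).HasGoodReductionAt v :=
  hasGoodReductionAt_of_valuation_Δ_eq_one_holds v _ (isIntegralAt_baseChange v W₀)
    (by rw [baseChange_int_Δ, Rat.valuation_intCast_eq_one_iff]; exact hv)

/-- Prime-indexed: `p ∤ Δ(W₀) ⇒` good reduction at `p`. [cite: SilvermanAEC2009, VII.5 Prop. 5.1(a)] -/
theorem hasGoodReductionAtPrime_baseChange_int_of_not_dvd [(W₀.baseChange ℚ).IsElliptic] {p : ℕ}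
    [hp : Fact p.Prime] (h : ¬ (p : ℤ) ∣ W₀.Δ) : (W₀.baseChange ℚ).HasGoodReductionAtPrime p := by
  set v := (Rat.HeightOneSpectrum.primesEquiv (R := ℤ)).symm ⟨p, hp.out⟩ with hv
  have hgen : Rat.HeightOneSpectrum.natGenerator v = p := Rat.natGenerator_primesEquiv_symm ⟨p, hp.out⟩
  exact ((W₀.baseChange ℚ).hasGoodReductionAtPrime_iff_hasGoodReductionAt_holds ⟨p, hp.out⟩).mpr
    (hasGoodReductionAt_baseChange_int_of_not_dvd W₀ (by rwa [hgen]))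

/-- Prime-indexed: `p ∣ Δ(W₀)`, `(Δ, c₄) = 1 ⇒` multiplicative reduction at `p`.
[cite: SilvermanAEC2009, VII.5 Prop. 5.1(b)] -/
theorem hasMultiplicativeReductionAtPrime_baseChange_int_of_isCoprime [(W₀.baseChange ℚ).IsElliptic]
    (hcop : IsCoprime W₀.Δ W₀.c₄) {p : ℕ} [hp : Fact p.Prime] (h : (p : ℤ) ∣ W₀.Δ) :
    (W₀.baseChange ℚ).HasMultiplicativeReductionAtPrime p := by
  set v := (Rat.HeightOneSpectrum.primesEquiv (R := ℤ)).symm ⟨p, hp.out⟩ with hv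
  have hgen : Rat.HeightOneSpectrum.natGenerator v = p := Rat.natGenerator_primesEquiv_symm ⟨p, hp.out⟩
  exact ((W₀.baseChange ℚ).hasMultiplicativeReductionAtPrime_iff_hasMultiplicativeReductionAt_holds
    ⟨p, hp.out⟩).mpr (hasMultiplicativeReductionAt_baseChange_int_of_isCoprime W₀ hcop (by rwa [hgen]))

/-- **The exponent of `p` in the conductor of a semistable integer model**: `1` if `p ∣ Δ(W₀)`, `0`
otherwise (`f_v = 0` at good, `= 1` at multiplicative places). [cite: Silverman1994, IV.10.2 (a),(b)] -/
theorem factorization_conductorNorm_baseChange_int_of_isCoprime [(W₀.baseChange ℚ).IsElliptic]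
    (hcop : IsCoprime W₀.Δ W₀.c₄) {p : ℕ} (hp : p.Prime) :
    ((W₀.baseChange ℚ).conductorNorm ℤ).factorization p = if (p : ℤ) ∣ W₀.Δ then 1 else 0 := by
  rw [show p = ((⟨p, hp⟩ : Nat.Primes) : ℕ) from rfl, factorization_conductorNorm_primesEquiv_symm]
  set v := (Rat.HeightOneSpectrum.primesEquiv (R := ℤ)).symm ⟨p, hp⟩ with hv
  have hgen : Rat.HeightOneSpectrum.natGenerator v = p := Rat.natGenerator_primesEquiv_symm ⟨p, hp⟩
  by_cases hd : (p : ℤ) ∣ W₀.Δ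
  · rw [if_pos hd]
    exact (conductorExponent_eq_one_iff_holds v _).mpr
      (hasMultiplicativeReductionAt_baseChange_int_of_isCoprime W₀ hcop (by rwa [hgen]))
  · rw [if_neg hd]
    exact (conductorExponent_eq_zero_iff_holds v _).mpr
      (hasGoodReductionAt_baseChange_int_of_not_dvd W₀ (by rwa [hgen]))

/-- **The conductor of a semistable integer model is the radical of its discriminant**: if `Δ(W₀)`,
`c₄(W₀)` are coprime and `N₀` is squarefree with `N₀ ∣ Δ ∣ N₀^k`, then `N_{W₀ ⊗ ℚ} = N₀`.
[cite: Silverman1994, IV.10.2 (a),(b)] -/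
theorem conductorNorm_baseChange_int_of_isCoprime [(W₀.baseChange ℚ).IsElliptic]
    (hcop : IsCoprime W₀.Δ W₀.c₄) {N₀ k : ℕ} (hsq : Squarefree N₀) (h₁ : (N₀ : ℤ) ∣ W₀.Δ)
    (h₂ : W₀.Δ ∣ (N₀ : ℤ) ^ k) : (W₀.baseChange ℚ).conductorNorm ℤ = N₀ := by
  have hN0 : N₀ ≠ 0 := hsq.ne_zero
  refine Nat.eq_of_factorization_eq ((W₀.baseChange ℚ).conductorNorm_pos_holds).ne' hN0 fun p ↦ ?_
  by_cases hp : p.Prime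
  swap
  · rw [Nat.factorization_eq_zero_of_not_prime _ hp, Nat.factorization_eq_zero_of_not_prime _ hp]
  rw [factorization_conductorNorm_baseChange_int_of_isCoprime W₀ hcop hp]
  by_cases hd : (p : ℤ) ∣ W₀.Δ
  · rw [if_pos hd]
    have hpN : p ∣ N₀ := by
      have : (p : ℤ) ∣ (N₀ : ℤ) ^ k := hd.trans h₂
      exact hp.dvd_of_dvd_pow (by exact_mod_cast this)
    have hle : N₀.factorization p ≤ 1 := Squarefree.natFactorization_le_one p hsq
    have hpos : 0 < N₀.factorization p := hp.factorization_pos_of_dvd hN0 hpN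
    omega
  · rw [if_neg hd]
    refine (Nat.factorization_eq_zero_of_not_dvd fun hpN ↦ hd ?_).symm
    exact (Int.natCast_dvd_natCast.mpr hpN).trans h₁

end IntModel

/-! ### §1 The curve `14A1 = [1, 0, 1, 4, −6]` -/

/-- Cremona `14A1 = [1, 0, 1, 4, −6]` as an integer model. [cite: CremonaAlgorithms1997, Table 1, N = 14, curve A1] -/
abbrev M14a1 : WeierstrassCurve ℤ := ⟨1, 0, 1, 4, -6⟩

/-- `14A1 / ℚ`. [cite: CremonaAlgorithms1997, Table 1, N = 14, curve A1] -/
abbrev c14a1 : WeierstrassCurve ℚ := M14a1.baseChange ℚ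

/-- `Δ(14A1) = −21952 = −2⁶·7³`. [cite: CremonaAlgorithms1997, Table 1, N = 14] -/
theorem M14a1_Δ : M14a1.Δ = -21952 := by decide

/-- `c₄(14A1) = −215`. [cite: CremonaAlgorithms1997, Table 1, N = 14] -/
theorem M14a1_c₄ : M14a1.c₄ = -215 := by decide

/-- `14A1` is an elliptic curve. [cite: CremonaAlgorithms1997, Table 1, N = 14] -/
theorem isElliptic_c14a1 : c14a1.IsElliptic := by
  rw [WeierstrassCurve.isElliptic_iff, baseChange_int_Δ, M14a1_Δ]; norm_num

/-- Cremona's model `14A1` is globally minimal (`|Δ| < 3¹²`, `2¹² ∤ Δ`).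
[cite: SilvermanAEC2009, VII.1 Remark 1.1] -/
theorem isGloballyMinimal_c14a1 : c14a1.IsGloballyMinimal :=
  isGloballyMinimal_baseChange_int M14a1 (forall_not_pow_dvd_or_of_bound M14a1 (B := 3)
    (by rw [M14a1_Δ]; decide) (by rw [M14a1_Δ]; decide) (by
      intro p hp hpr
      have hp3 : p < 3 := Finset.mem_range.mp hp
      interval_cases p
      · exact absurd hpr (by decide)
      · exact absurd hpr (by decide)
      · left
        rw [M14a1_Δ]
        decide))

/-- `Δ(14A1)` and `c₄(14A1)` are coprime (semistable). [cite: SilvermanAEC2009, VII.5 Prop. 5.1(b)] -/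
theorem M14a1_coprime : IsCoprime M14a1.Δ M14a1.c₄ := by
  rw [M14a1_Δ, M14a1_c₄, Int.isCoprime_iff_gcd_eq_one]; decide

/-- **The conductor of `14A1` is `14 = 2·7`.** [cite: CremonaAlgorithms1997, Table 1, N = 14] -/
theorem conductorNorm_c14a1 : c14a1.conductorNorm ℤ = 14 := by
  haveI := isElliptic_c14a1
  refine conductorNorm_baseChange_int_of_isCoprime M14a1 M14a1_coprime (k := 6) ?_ ?_ ?_
  · rw [Nat.squarefree_iff_nodup_primeFactorsList (by norm_num)]; simp
  · rw [M14a1_Δ]; decide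
  · rw [M14a1_Δ]; decide

/-- `14A1` is multiplicative at `2`. [cite: SilvermanAEC2009, VII.5 Prop. 5.1(b)] -/
theorem hasMultiplicativeReductionAtPrime_c14a1_two : c14a1.HasMultiplicativeReductionAtPrime 2 := by
  haveI := isElliptic_c14a1
  exact hasMultiplicativeReductionAtPrime_baseChange_int_of_isCoprime M14a1 M14a1_coprime
    (by rw [M14a1_Δ]; decide)

/-- `14A1` is multiplicative at `7`. [cite: SilvermanAEC2009, VII.5 Prop. 5.1(b)] -/
theorem hasMultiplicativeReductionAtPrime_c14a1_seven [Fact (Nat.Prime 7)] :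
    c14a1.HasMultiplicativeReductionAtPrime 7 := by
  haveI := isElliptic_c14a1
  exact hasMultiplicativeReductionAtPrime_baseChange_int_of_isCoprime M14a1 M14a1_coprime
    (by rw [M14a1_Δ]; decide)

/-- `14A1` has good reduction at every prime `ℓ ∉ {2, 7}`. [cite: SilvermanAEC2009, VII.5 Prop. 5.1(a)] -/
theorem hasGoodReductionAtPrime_c14a1 {ℓ : ℕ} [hℓ : Fact ℓ.Prime] (h2 : ℓ ≠ 2) (h7 : ℓ ≠ 7) :
    c14a1.HasGoodReductionAtPrime ℓ := by
  haveI := isElliptic_c14a1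
  refine hasGoodReductionAtPrime_baseChange_int_of_not_dvd M14a1 ?_
  rw [M14a1_Δ]
  intro hd
  have hd' : ℓ ∣ 2 ^ 6 * 7 ^ 3 := by exact_mod_cast Int.dvd_neg.mp hd
  rcases (Nat.Prime.dvd_mul hℓ.out).mp hd' with h | h
  · exact h2 ((Nat.prime_dvd_prime_iff_eq hℓ.out Nat.prime_two).mp (hℓ.out.dvd_of_dvd_pow h))
  · exact h7 ((Nat.prime_dvd_prime_iff_eq hℓ.out (by norm_num)).mp (hℓ.out.dvd_of_dvd_pow h))

/-- `14A1 mod 2 = [1, 0, 1, 0, 0]`. [cite: CremonaAlgorithms1997, Table 1, N = 14, curve A1] -/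
theorem M14a1_mod_two : M14a1.map (Int.castRingHom (ZMod 2)) = ⟨1, 0, 1, 0, 0⟩ := by
  ext <;> decide

/-- `14A1 mod 7 = [1, 0, 1, 4, 1]`. [cite: CremonaAlgorithms1997, Table 1, N = 14, curve A1] -/
theorem M14a1_mod_seven : M14a1.map (Int.castRingHom (ZMod 7)) = ⟨1, 0, 1, 4, 1⟩ := by
  ext <;> decide

/-- A quadratic `aX² + bX + c` over `𝔽₂` with no root (`c ≠ 0`, `a + b + c ≠ 0`) does not split.
[folklore] -/
private theorem not_splits_quadratic_F2 {a b c : ZMod 2} (ha : a ≠ 0) (h0 : c ≠ 0)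
    (h1 : a + b + c ≠ 0) : ¬ (C a * X ^ 2 + C b * X + C c).Splits := by
  intro hs
  have hdeg : (C a * X ^ 2 + C b * X + C c).degree ≠ 0 := by
    rw [Polynomial.degree_quadratic ha]; decide
  obtain ⟨r, hr⟩ := hs.exists_eval_eq_zero hdeg
  have hr' : a * r ^ 2 + b * r + c = 0 := by
    simpa [eval_add, eval_mul, eval_pow, eval_C, eval_X] using hr
  have h01 : ∀ t : ZMod 2, t = 0 ∨ t = 1 := by decide
  rcases h01 r with rfl | rfl
  · exact h0 (by simpa using hr')
  · exact h1 (by simpa using hr')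

/-- **`14A1` is NON-SPLIT multiplicative at `2`** (`a₂ = −1`, `2 ∈ N`): the node-tangent quadratic is
`X² + X + 1`, irreducible over `𝔽₂`. [cite: BurungaleSkinner2023, Example (E1) (p. 22) ("N = {2}")] -/
theorem not_hasSplitMultiplicativeReductionAtPrime_c14a1_two :
    ¬ c14a1.HasSplitMultiplicativeReductionAtPrime 2 := by
  haveI := isElliptic_c14a1
  haveI := isGloballyMinimal_c14a1
  have hint : integralModelInt c14a1 = M14a1 := integralModelInt_baseChange_int M14a1
  have hΔ : ((2 : ℕ) : ℤ) ∣ (integralModelInt c14a1).Δ := by rw [hint, M14a1_Δ]; decide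
  have hc₄ : ¬ ((2 : ℕ) : ℤ) ∣ (integralModelInt c14a1).c₄ := by rw [hint, M14a1_c₄]; decide
  rw [LocalTorsionMult.hasSplitMultiplicativeReductionAtPrime_iff_splits_integralModelInt c14a1 2 hΔ
    hc₄, hint, M14a1_mod_two]
  dsimp only
  rw [sub_eq_add_neg, ← C_neg]
  exact not_splits_quadratic_F2 (by decide) (by decide) (by decide)

/-- `c₄`, `b₂`, `b₄`, `b₆` of `14A1 mod 7`. [folklore] -/
private theorem invariants_mod_seven :
    (⟨1, 0, 1, 4, 1⟩ : WeierstrassCurve (ZMod 7)).c₄ = 2 ∧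
      (⟨1, 0, 1, 4, 1⟩ : WeierstrassCurve (ZMod 7)).b₂ = 1 ∧
      (⟨1, 0, 1, 4, 1⟩ : WeierstrassCurve (ZMod 7)).b₄ = 2 ∧
      (⟨1, 0, 1, 4, 1⟩ : WeierstrassCurve (ZMod 7)).b₆ = 5 := by
  refine ⟨by decide, by decide, by decide, by decide⟩

/-- The node-tangent quadratic of `14A1 mod 7` factors as `2(X − 4)(X − 2)`. [folklore] -/
private theorem nodeQuadratic_mod_seven :
    (C (2 : ZMod 7) * X ^ 2 + C ((1 : ZMod 7) * 2) * X - C ((54 : ZMod 7) * 5 - 3 * 1 * 2 + 0 * 2)) =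
      C (2 : ZMod 7) * ((X - C 4) * (X - C 2)) := by
  have h1 : ((1 : ZMod 7) * 2) = -(2 * (4 + 2)) := by decide
  have h2 : ((54 : ZMod 7) * 5 - 3 * 1 * 2 + 0 * 2) = -(2 * 4 * 2) := by decide
  rw [h1, h2]
  simp only [map_neg, map_mul, map_add]
  ring

/-- **`14A1` is SPLIT multiplicative at `7`** (`a₇ = +1`, `7 ∈ S`): the node-tangent quadratic is
`2X² + 2X − 5 = 2(X − 4)(X − 2)` over `𝔽₇`. [cite: BurungaleSkinner2023, Example (E1) (p. 22) ("S = {7}")] -/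
theorem hasSplitMultiplicativeReductionAtPrime_c14a1_seven [Fact (Nat.Prime 7)] :
    c14a1.HasSplitMultiplicativeReductionAtPrime 7 := by
  haveI := isElliptic_c14a1
  haveI := isGloballyMinimal_c14a1
  have hint : integralModelInt c14a1 = M14a1 := integralModelInt_baseChange_int M14a1
  have hΔ : ((7 : ℕ) : ℤ) ∣ (integralModelInt c14a1).Δ := by rw [hint, M14a1_Δ]; decide
  have hc₄ : ¬ ((7 : ℕ) : ℤ) ∣ (integralModelInt c14a1).c₄ := by rw [hint, M14a1_c₄]; decide
  rw [LocalTorsionMult.hasSplitMultiplicativeReductionAtPrime_iff_splits_integralModelInt c14a1 7 hΔ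
    hc₄, hint, M14a1_mod_seven]
  obtain ⟨e1, e2, e3, e4⟩ := invariants_mod_seven
  dsimp only
  rw [e1, e2, e3, e4, nodeQuadratic_mod_seven]
  exact (Splits.C _).mul ((Splits.X_sub_C _).mul (Splits.X_sub_C _))

/-! ### §2 The rational `3`-torsion point `T₃ = (2, 2)` and the line `Φ = ⟨T̄₃⟩` -/

/-- The coefficients of `14A1 / ℚ`. [cite: CremonaAlgorithms1997, Table 1, N = 14] -/
theorem c14a1_eq : c14a1 = ⟨1, 0, 1, 4, -6⟩ := by
  ext <;> simp [WeierstrassCurve.baseChange, WeierstrassCurve.map]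

/-- `T₃ = (2, 2) ∈ 14A1(ℚ)` (`ψ₃(2) = 0`: a point of order `3`; `E(ℚ)_{tors} = ℤ/6`).
[cite: CremonaAlgorithms1997, Table 1, N = 14, curve A1 (|T| = 6)] -/
def T₃ : c14a1.toAffine.Point :=
  Affine.Point.some 2 2 ((Affine.nonsingular_iff' _ _).mpr
    ⟨(Affine.equation_iff _ _).mpr (by rw [c14a1_eq]; norm_num),
      Or.inr (by rw [c14a1_eq]; norm_num)⟩)

/-- `T₃ ≠ O`. [cite: CremonaAlgorithms1997, Table 1, N = 14, curve A1 (|T| = 6)] -/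
theorem T₃_ne_zero : T₃ ≠ 0 := Affine.Point.some_ne_zero _

/-- **`T₃ + T₃ = −T₃`** (tangent slope `2` at `(2,2)`; `−T₃ = (2, −5)`), polymorphic in the
`DecidableEq ℚ` instance behind Mathlib's group law. [cite: CremonaAlgorithms1997, Table 1, N = 14] -/
theorem T₃_add_T₃ [DecidableEq ℚ] : T₃ + T₃ = -T₃ := by
  have hy : (2 : ℚ) ≠ c14a1.toAffine.negY 2 2 := by rw [c14a1_eq]; norm_num [Affine.negY]
  unfold T₃
  rw [Affine.Point.add_self_of_Y_ne hy, Affine.Point.neg_some]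
  congr 1
  · rw [Affine.slope_of_Y_ne rfl hy, c14a1_eq]
    norm_num [Affine.addX, Affine.negY]
  · rw [Affine.slope_of_Y_ne rfl hy, c14a1_eq]
    norm_num [Affine.addY, Affine.negAddY, Affine.addX, Affine.negY]

/-- **`3 T₃ = O`.** [cite: CremonaAlgorithms1997, Table 1, N = 14, curve A1] -/
theorem three_nsmul_T₃ [DecidableEq ℚ] : (3 : ℕ) • T₃ = 0 := by
  rw [show (3 : ℕ) = 2 + 1 from rfl, add_nsmul, two_nsmul, one_nsmul, T₃_add_T₃, neg_add_cancel]

/-- The geometric point `T̄₃ ∈ 14A1(ℚ̄)` of `T₃` (Mathlib's `Affine.Point.map` along `ℚ → ℚ̄`,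
spelled with the `DecidableEq ℚ` instance of this file; definitionally the tree's
`toGeomPoints c14a1 T₃`). [cite: SilvermanAEC2009, VIII.§1] -/
def T₃bar : geomPoints c14a1 :=
  Affine.Point.map (W' := c14a1.toAffine) (S := ℚ) (Algebra.ofId ℚ (AlgebraicClosure ℚ)) T₃

/-- `T̄₃` is the tree's `toGeomPoints c14a1 T₃`. [cite: SilvermanAEC2009, VIII.§1] -/
theorem toGeomPoints_T₃ : toGeomPoints c14a1 T₃ = T₃bar := rfl

/-- `3 T̄₃ = O`. [cite: CremonaAlgorithms1997, Table 1, N = 14, curve A1 (|T| = 6)] -/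
theorem three_nsmul_T₃bar : (3 : ℕ) • T₃bar = 0 := by
  have h := map_nsmul (Affine.Point.map (W' := c14a1.toAffine) (S := ℚ)
    (Algebra.ofId ℚ (AlgebraicClosure ℚ))) 3 T₃
  rw [three_nsmul_T₃, map_zero] at h
  exact h.symm

/-- `T̄₃ ≠ O`. [cite: CremonaAlgorithms1997, Table 1, N = 14, curve A1 (|T| = 6)] -/
theorem T₃bar_ne_zero : T₃bar ≠ 0 := fun h =>
  T₃_ne_zero (Affine.Point.map_injective (W' := c14a1.toAffine)
    (f := Algebra.ofId ℚ (AlgebraicClosure ℚ)) (h.trans (map_zero _).symm))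

/-- `T̄₃` is `Γ_ℚ`-fixed (Galois descent, Silverman VIII.§1). [cite: SilvermanAEC2009, VIII.§1] -/
theorem smul_T₃bar (σ : Field.absoluteGaloisGroup ℚ) : σ • T₃bar = T₃bar :=
  smul_toGeomPoints c14a1 σ T₃

/-- `T̄₃ ∈ E[3]`. [cite: CremonaAlgorithms1997, Table 1, N = 14, curve A1 (|T| = 6)] -/
theorem T₃bar_mem_geomTorsion : T₃bar ∈ geomTorsion c14a1 ((3 : ℕ) : ℤ) := by
  rw [mem_torsionBy_iff, natCast_zsmul]
  exact three_nsmul_T₃bar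

/-- `T̄₃` has order exactly `3`. [cite: CremonaAlgorithms1997, Table 1, N = 14, curve A1 (|T| = 6)] -/
theorem addOrderOf_T₃bar : addOrderOf T₃bar = 3 :=
  addOrderOf_eq_prime three_nsmul_T₃bar T₃bar_ne_zero

/-- **The rational `3`-torsion line `Φ = ⟨T̄₃⟩ ≤ E[3]` of `14A1`**: `3` elements, trivial
`Γ_ℚ`-action (`ϕ = 1`). [cite: BurungaleSkinner2023, Example (E1) (p. 22) ("ϕ = 1")] -/
theorem line_c14a1 :
    ∃ Φ : AddSubgroup (geomTorsion c14a1 ((3 : ℕ) : ℤ)),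
      Nat.card Φ = 3 ∧ ∀ (σ : Field.absoluteGaloisGroup ℚ), ∀ P ∈ Φ, σ • P = P := by
  set Tt : geomTorsion c14a1 ((3 : ℕ) : ℤ) := ⟨T₃bar, T₃bar_mem_geomTorsion⟩ with hTt
  have hfix : ∀ σ : Field.absoluteGaloisGroup ℚ, σ • Tt = Tt := fun σ =>
    Subtype.ext (smul_T₃bar σ)
  have hord : addOrderOf Tt = 3 := by
    rw [← AddSubgroup.addOrderOf_coe]
    exact addOrderOf_T₃bar
  refine ⟨AddSubgroup.zmultiples Tt, ?_, ?_⟩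
  · rw [Nat.card_zmultiples, hord]
  · intro σ P hP
    obtain ⟨k, rfl⟩ := AddSubgroup.mem_zmultiples_iff.mp hP
    rw [smul_comm σ k Tt, hfix]

/-! ### §3 Theorems 2.9, 3.2, 3.5 for `14A1` (`p = 3`, `ℓ₀ = 2`), modulo the named facts -/

/-- **Thm. 2.9 for `14A1`**: granting `thm29_posProportion_twists_rankOne_nondegenerate`, for a
positive proportion of discriminants `d` of imaginary quadratic fields `TwistConclusion 14A1 3 d`
(`rank E^{(d)}(ℚ) = ord_{s=1} L(E^{(d)}, s) = 1`, `λ = 1`, non-degenerate `3`-adic height on every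
global minimal model). Hypotheses kernel-checked: `3 ∤ N = 14`, `Φ = ⟨T̄₃⟩` rational with `ϕ = 1`
(even, unramified at `3`), `ℓ₀ = 2 ∣ N`, `r₂ = 1`, `2 ≡ −1 (mod 3)`.
[cite: BurungaleSkinner2023, Thm. 2.9 (p. 21) with Example (E1) (p. 22)] -/
theorem posProportion_twists_c14a1 (h : thm29_posProportion_twists_rankOne_nondegenerate) :
    haveI := isElliptic_c14a1
    haveI := isGloballyMinimal_c14a1
    OddQuadraticCharPosProportion fun d ↦ TwistConclusion c14a1 3 d := by
  haveI := isElliptic_c14a1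
  haveI := isGloballyMinimal_c14a1
  obtain ⟨Φ, hcard, htriv⟩ := line_c14a1
  exact h c14a1 Φ 2 (by rw [conductorNorm_c14a1]; decide)
    ⟨hcard, fun σ P hP => by rw [htriv σ P hP]; exact hP⟩
    (Or.inl ⟨lineEven_of_forall_smul_eq htriv, lineUnramifiedAt_of_forall_smul_eq htriv⟩)
    (by rw [conductorNorm_c14a1]; decide) numPrimesAbove_three_two (fun _ => by decide)

/-- **Infinitely many quadratic twists of `14A1` with `rank = ord_{s=1} L = 1` and non-degenerate
`3`-adic height**, modulo Thm. 2.9 by name (positive proportion ⇒ infinitely many,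
`OddQuadraticCharPosProportion.infinite`). [cite: BurungaleSkinner2023, Thm. 2.9 (p. 21) with Example (E1) (p. 22)] -/
theorem infinitelyMany_twists_c14a1 (h : thm29_posProportion_twists_rankOne_nondegenerate) :
    haveI := isElliptic_c14a1
    haveI := isGloballyMinimal_c14a1
    {d : ℤ | IsOddQuadraticCharDiscr d ∧ TwistConclusion c14a1 3 d}.Infinite :=
  (posProportion_twists_c14a1 h).infinite

/-- **Thm. 3.2 for `14A1`**: granting `thm32_posProportion_twists_pPartBSD`, infinitely many
discriminants `d` of imaginary quadratic fields with `ord_{s=1} L(E^{(d)}, s) = 1` and the printed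
`3`-part of the BSD formula (`PPartRankOnePrintShape W' 3`) for every global minimal model `W'` of
`E^{(d)}`. [cite: BurungaleSkinner2023, Thm. 3.2 (p. 25) with Example (E1) (p. 22)] -/
theorem infinitelyMany_twists_c14a1_pPartBSD (h : thm32_posProportion_twists_pPartBSD) :
    haveI := isElliptic_c14a1
    haveI := isGloballyMinimal_c14a1
    {d : ℤ | IsOddQuadraticCharDiscr d ∧
      ((c14a1.quadraticTwist (d : ℚ)).analyticRank = 1 ∧
        ∀ (W' : WeierstrassCurve ℚ) [W'.IsElliptic] [W'.IsGloballyMinimal] (C : VariableChange ℚ),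
          C • c14a1.quadraticTwist (d : ℚ) = W' → PPartRankOnePrintShape W' 3)}.Infinite := by
  haveI := isElliptic_c14a1
  haveI := isGloballyMinimal_c14a1
  obtain ⟨Φ, hcard, htriv⟩ := line_c14a1
  exact (h c14a1 Φ 2 (by rw [conductorNorm_c14a1]; decide)
    ⟨hcard, fun σ P hP => by rw [htriv σ P hP]; exact hP⟩
    (Or.inl ⟨lineEven_of_forall_smul_eq htriv, lineUnramifiedAt_of_forall_smul_eq htriv⟩)
    (by rw [conductorNorm_c14a1]; decide) numPrimesAbove_three_two (fun _ => by decide)).infinite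

/-- **Thm. 3.5 for `14A1`**: granting `thm35_posProportion_evenTwists_pPartBSD_rankZero`,
infinitely many discriminants `d` of REAL quadratic fields with `L(E^{(d)}, 1) ≠ 0` and the printed
`3`-part of the rank-zero BSD formula for every global minimal model of `E^{(d)}`.
[cite: BurungaleSkinner2023, Thm. 3.5 (p. 27) with Example (E1) (p. 22)] -/
theorem infinitelyMany_evenTwists_c14a1_pPartBSD_rankZero
    (h : thm35_posProportion_evenTwists_pPartBSD_rankZero) :
    haveI := isElliptic_c14a1
    haveI := isGloballyMinimal_c14a1
    {d : ℤ | IsEvenQuadraticCharDiscr d ∧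
      ((c14a1.quadraticTwist (d : ℚ)).entireLFunction 1 ≠ 0 ∧
        ∀ (W' : WeierstrassCurve ℚ) [W'.IsElliptic] [W'.IsGloballyMinimal] (C : VariableChange ℚ),
          C • c14a1.quadraticTwist (d : ℚ) = W' → PPartRankZeroPrintShape W' 3)}.Infinite := by
  haveI := isElliptic_c14a1
  haveI := isGloballyMinimal_c14a1
  obtain ⟨Φ, hcard, htriv⟩ := line_c14a1
  exact (h c14a1 Φ 2 (by rw [conductorNorm_c14a1]; decide)
    ⟨hcard, fun σ P hP => by rw [htriv σ P hP]; exact hP⟩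
    (Or.inl ⟨lineEven_of_forall_smul_eq htriv, lineUnramifiedAt_of_forall_smul_eq htriv⟩)
    (by rw [conductorNorm_c14a1]; decide) numPrimesAbove_three_two (fun _ => by decide)).infinite

/-! ### §4 Theorem 2.8 for `14A1`, `ℓ₀ = 2`, `ψ = ψ_{ℚ(√−43)}` -/

/-- **Inert case of the decomposition law at `2`, ideal-theoretically: `d_K ≡ 5 (mod 8) ⇒ 2𝓞_K`
is a prime ideal** (`Zhai2016.IsInertIn K 2`). With an integral basis `(1, ω)`, `ω² = m + tω`,
`d_K = t² + 4m ≡ 5 (mod 8)` forces `t`, `m` odd, and `X² − tX − m ≡ X² + X + 1 (mod 2)` has no root.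
[cite: Marcus2018, Ch. 3 Thm. 25 (decomposition law at 2: d ≡ 5 (mod 8) inert)] -/
theorem isInertIn_two_of_discr_emod_eight {K : Type} [Field K] [NumberField K]
    (h2 : Module.finrank ℚ K = 2) (h5 : NumberField.discr K % 8 = 5) : Zhai2016.IsInertIn K 2 := by
  obtain ⟨b, hb⟩ := exists_basis_zero_eq_one h2
  have hω := basis_one_mul_self_eq b hb
  have hdisc := discr_eq_sq_add_four_mul b hb
  unfold Zhai2016.IsInertIn
  rw [Int.cast_natCast]
  refine Literature.NumberTheory.QuadraticFields.RingClass.isPrime_span_natCast_of_forall_ne b hb hω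
    fun c hc => ?_
  rw [hdisc] at h5
  generalize b.repr (b 1 * b 1) 1 = t at h5 hc
  generalize b.repr (b 1 * b 1) 0 = m at h5 hc
  have h20 : (2 : ZMod 2) = 0 := rfl
  -- `t` and `m` are odd
  obtain ⟨k, rfl | rfl⟩ := Int.even_or_odd' t <;> obtain ⟨j, rfl | rfl⟩ := Int.even_or_odd' m
  · exfalso
    have : (2 * k) ^ 2 + 4 * (2 * j) = 4 * (k ^ 2 + 2 * j) := by ring
    rw [this] at h5
    generalize k ^ 2 + 2 * j = y at h5
    omega
  · exfalso
    have : (2 * k) ^ 2 + 4 * (2 * j + 1) = 4 * (k ^ 2 + 2 * j + 1) := by ring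
    rw [this] at h5
    generalize k ^ 2 + 2 * j + 1 = y at h5
    omega
  · exfalso
    have : (2 * k + 1) ^ 2 + 4 * (2 * j) = 8 * (k * (k + 1) / 2) + 8 * j + 1 := by
      have he : 2 ∣ k * (k + 1) := by
        rcases Int.even_or_odd k with ⟨r, hr⟩ | ⟨r, hr⟩
        · exact ⟨r * (k + 1), by rw [hr]; ring⟩
        · exact ⟨k * (r + 1), by rw [hr]; ring⟩
      have := Int.ediv_mul_cancel he
      nlinarith [this]
    omega
  · have ht : ((2 * k + 1 : ℤ) : ZMod 2) = 1 := by
      rw [Int.cast_add, Int.cast_mul, Int.cast_ofNat, h20, zero_mul, zero_add, Int.cast_one]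
    have hm : ((2 * j + 1 : ℤ) : ZMod 2) = 1 := by
      rw [Int.cast_add, Int.cast_mul, Int.cast_ofNat, h20, zero_mul, zero_add, Int.cast_one]
    rw [ht, hm] at hc
    have hall : ∀ r : ZMod 2, r ^ 2 - 1 * r - 1 ≠ 0 := by decide
    exact hall c hc

/-- **All hypotheses of Thm. 2.8 for `(14A1, Φ = ⟨T̄₃⟩, ℓ₀ = 2, K = K' = an imaginary quadratic field
of discriminant −43)`**: `3 ∤ 14`; `ϕ = 1`; `2 ∣ 14`, `r₂ = 1`, `2 ≡ −1 (mod 3)`; `3 ∤ 43`;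
(a) `2 ∈ N` and `ψ(2) = −1` (`−43 ≡ 5 (mod 8)`; and `14A1` is not split at `2`); (b) `7 ∈ S`,
`ψ(7) = −1` (`(−43/7) = −1`); (c)–(e) void (`14A1` is split at `7`, good outside `{2, 7}`);
(f) `ψ(3) = −1` (`(−43/3) = −1`); (g) `h(−43) = 1`.
[cite: BurungaleSkinner2023, Thm. 2.8 (hypotheses, p. 20) with Example (E1) (p. 22)] -/
theorem thm28Hypotheses_c14a1_of_discr_eq_neg_fortyThree (K : Type) [Field K] [NumberField K]
    (hK : IsImaginaryQuadratic K) (hd : NumberField.discr K = -43) :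
    haveI := isGloballyMinimal_c14a1
    ∃ Φ : AddSubgroup (geomTorsion c14a1 ((3 : ℕ) : ℤ)), Thm28Hypotheses c14a1 Φ 2 K K := by
  haveI := isElliptic_c14a1
  haveI := isGloballyMinimal_c14a1
  obtain ⟨Φ, hcard, htriv⟩ := line_c14a1
  have h7 : ∀ (ℓ : ℕ) [Fact ℓ.Prime], ℓ ≠ 2 → ℓ ≠ 7 → ¬ c14a1.HasMultiplicativeReductionAtPrime ℓ :=
    fun ℓ _ h2 h7 => (hasGoodReductionAtPrime_c14a1 h2 h7).not_hasMultiplicativeReduction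
  have hgood : ∀ (ℓ : ℕ) [Fact ℓ.Prime], ℓ ≠ 2 → ¬ Addv c14a1 ℓ := by
    intro ℓ _ h2 hA
    by_cases h7' : ℓ = 7
    · subst h7'
      exact hA.2 hasMultiplicativeReductionAtPrime_c14a1_seven
    · exact hA.1 (hasGoodReductionAtPrime_c14a1 h2 h7')
  refine ⟨Φ, ?_⟩
  exact {
    three_not_dvd_conductor := by rw [conductorNorm_c14a1]; decide
    isRationalLine := ⟨hcard, fun σ P hP => by rw [htriv σ P hP]; exact hP⟩
    lineEven := lineEven_of_forall_smul_eq htriv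
    lineUnramifiedAt := lineUnramifiedAt_of_forall_smul_eq htriv
    ell0_dvd_conductor := by rw [conductorNorm_c14a1]; decide
    numPrimesAbove_ell0 := numPrimesAbove_three_two
    lineUnramifiedAt_ell0 := lineUnramifiedAtPrime_of_forall_smul_eq htriv 2
    ell0_mod_three_of_addv := fun _ => by decide
    isImaginaryQuadratic := hK
    isImaginaryQuadratic' := hK
    isProductCharacterField := isProductCharacterField_self_of_isImaginaryQuadratic htriv K hK
    three_not_dvd_discr := by rw [hd]; decide
    lineUnramifiedAt_of_dvd_discr := fun ℓ _ _ => lineUnramifiedAtPrime_of_forall_smul_eq htriv ℓ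
    a_split := fun hs => absurd hs not_hasSplitMultiplicativeReductionAtPrime_c14a1_two
    a_nonsplit := fun _ _ => isInertIn_two_of_discr_emod_eight hK.1 (by rw [hd]; decide)
    a_addv := fun _ => by rw [hd]; decide
    b := by
      intro ℓ _ h2 hs
      by_cases h7' : ℓ = 7
      · subst h7'
        exact Or.inr (isInertIn_of_legendreSym_eq_neg_one hK.1 (by rw [hd]; norm_num))
      · exact absurd hs.hasMultiplicativeReductionAtPrime (h7 ℓ h2 h7')
    c := by
      intro ℓ _ h2 hm hns
      by_cases h7' : ℓ = 7
      · subst h7'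
        exact absurd hasSplitMultiplicativeReductionAtPrime_c14a1_seven hns
      · exact absurd hm (h7 ℓ h2 h7')
    d := fun ℓ _ h2 hA _ _ => absurd hA (hgood ℓ h2)
    e := fun ℓ _ h2 hA _ _ => absurd hA (hgood ℓ h2)
    f := isInertIn_of_legendreSym_eq_neg_one hK.1 (by rw [hd]; norm_num)
    g := by rw [classNumber_eq_one_of_discr_mem hK.1 (by rw [hd]; decide)]; decide }

/-- **The `−43` twist of `14A1`, modulo Thm. 2.8 by name**: granting
`thm28_twist_rankOne_nondegenerate`, `rank E^{(−43)}(ℚ) = ord_{s=1} L(E^{(−43)}, s) = 1`,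
`λ(L_{E^{(−43)}}) = 1`, and the `3`-adic height pairing on every global minimal model of `E^{(−43)}`,
`E = 14A1`, is NON-DEGENERATE — every hypothesis of Thm. 2.8 kernel-checked (so the typed bundle
`Thm28Hypotheses` is inhabited). [cite: BurungaleSkinner2023, Thm. 2.8 (pp. 20–21) with Example (E1) (p. 22)] -/
theorem twistConclusion_c14a1_neg_fortyThree (h : thm28_twist_rankOne_nondegenerate) :
    haveI := isElliptic_c14a1
    haveI := isGloballyMinimal_c14a1
    TwistConclusion c14a1 3 (-43) := by
  haveI := isElliptic_c14a1
  haveI := isGloballyMinimal_c14a1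
  obtain ⟨K, _, _, hK, hd⟩ := isOddQuadraticCharDiscr_neg_fortyThree
  obtain ⟨Φ, hΦ⟩ := thm28Hypotheses_c14a1_of_discr_eq_neg_fortyThree K hK hd
  have hc := h c14a1 Φ 2 K K hΦ
  rwa [hd] at hc

/-- **The `3`-part of BSD for the `−43` twist of `14A1`, modulo Thm. 3.1 by name.**
[cite: BurungaleSkinner2023, Thm. 3.1 (p. 25) with Example (E1) (p. 22)] -/
theorem pPartBSD_twist_c14a1_neg_fortyThree (h : thm31_twist_pPartBSD_rankOne) :
    haveI := isElliptic_c14a1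
    (c14a1.quadraticTwist ((-43 : ℤ) : ℚ)).analyticRank = 1 ∧
      ∀ (W' : WeierstrassCurve ℚ) [W'.IsElliptic] [W'.IsGloballyMinimal] (C : VariableChange ℚ),
        C • c14a1.quadraticTwist ((-43 : ℤ) : ℚ) = W' → PPartRankOnePrintShape W' 3 := by
  haveI := isElliptic_c14a1
  haveI := isGloballyMinimal_c14a1
  obtain ⟨K, _, _, hK, hd⟩ := isOddQuadraticCharDiscr_neg_fortyThree
  obtain ⟨Φ, hΦ⟩ := thm28Hypotheses_c14a1_of_discr_eq_neg_fortyThree K hK hd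
  have hc := h c14a1 3 2 K K (Or.inl ⟨rfl, Φ, hΦ⟩)
  rwa [hd] at hc

end Literature.NumberTheory.EllipticCurves.BurungaleSkinner2023

end
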